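import Literature.Probability.Percolation.ThinAnnulusCircuits
import Literature.Probability.Percolation.HalfSpaceBrickSeeds
import HarnessLib

/-!
# Six arms from five arms, II: open winding circuits in square annuli and the decay of their
absence (support file for the stub `stub_sixArm_of_fiveArm`, crux stmt-CriticalPhenomena-10268)

The sixth (closed dual) arm of the six-arm event is certified, in the Reimer decomposition
`𝒜₆ ⊆ 𝒜₅ □ 𝒟`, by the DECREASING event `𝒟` = "in none of `J ≍ log (n/m)` disjoint geometric
sub-annuli of `A_{m,n}` is there an open closed walk of non-zero winding number about the face
`[0,1]²`" (`walkWinding · 0`, `PlanarDuality.lean`; the winding form is what the blocking lemma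
`sixArmOfFiveArm_walkWinding_eq_zero` of file `…SixArmOfFiveArmWinding` speaks about).  This file
bounds `P_{1/2}(𝒟)` for critical bond percolation on `ℤ²`: four long-way box crossings give an open
closed walk of `A_{a,b}` of winding `-1` (the construction of `mem_openCircuitInAnnulus_of_crossings`,
Grimmett 1999 (11.78), stopped before the cycle extraction), whence by RSW + Harris a uniform lower
bound `ρ_k` at bounded aspect ratio (`sixArmOfFiveArm_exists_pos_le_real_windingCircuit`); locality
(`sixArmOfFiveArm_determinedBy_windingCircuit`); independence over the disjoint annuli
`A_{4ⁱm, 2·4ⁱm}` (`bondPercolation_real_biInter_eq_prod`) gives `q^J`, i.e.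
**`P_{1/2}(𝒟_{m,n}) ≤ 2^a (m/n)^a`**, `a = log_{1/4} max(1 - ρ₄, 1/4)`, all `2 ≤ m ≤ n`
(`sixArmOfFiveArm_real_noWindingCircuits_le_rpow`).  References: G. Grimmett, *Percolation* (1999),
§11.7; H. Kesten, *Percolation theory for mathematicians* (1982), §2.
-/

noncomputable section

open Set SimpleGraph MeasureTheory
open Literature.Probability.Percolation Literature.Probability.LatticeModels

namespace Summit.CriticalPhenomena.CardyFormulaZ2.Cruxes.LagHandOff.HittingTournament

-- adapted from Literature/Probability/Percolation/ThinAnnulusCircuits.lean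
-- (`mem_openCircuitInAnnulus_of_crossings`), stopped before the cycle extraction
/-- **Four crossings give an open winding circuit of `A_{a,b}`** (Grimmett 1999, (11.78) /
Fig. 11.27, at arbitrary thickness). For `1 ≤ a < b` and a lattice configuration `ω`: if the top
box `[-b, b] × [a, b]` and the bottom box `[-b, b] × [-b, -a]` have open left-right crossings and
the left box `[-b, -a] × [-b, b]` and the right box `[a, b] × [-b, b]` have open top-bottom
crossings, then some closed lattice walk of `A_{a,b}` with open edges has winding number `≠ 0`
about the face `[0,1]²`. -/
theorem sixArmOfFiveArm_exists_windingCircuit_of_crossings {a b : ℕ} (ha : 1 ≤ a) (hab : a < b)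
    {ω : BondConfig (Site 2)} (hω : ω ⊆ (zdGraph 2).edgeSet)
    (hT : ω ∈ lrCrossingAt ![-(b : ℤ), (a : ℤ)] (2 * b) (b - a))
    (hB : ω ∈ lrCrossingAt ![-(b : ℤ), -(b : ℤ)] (2 * b) (b - a))
    (hL : ω ∈ openCrossing ((· + ![-(b : ℤ), -(b : ℤ)]) '' (rectangle (b - a) (2 * b) : Set (Site 2)))
      ((· + ![-(b : ℤ), -(b : ℤ)]) '' (bottomSide (b - a) (2 * b) : Set (Site 2)))
      ((· + ![-(b : ℤ), -(b : ℤ)]) '' (topSide (b - a) (2 * b) : Set (Site 2))))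
    (hR : ω ∈ openCrossing ((· + ![(a : ℤ), -(b : ℤ)]) '' (rectangle (b - a) (2 * b) : Set (Site 2)))
      ((· + ![(a : ℤ), -(b : ℤ)]) '' (bottomSide (b - a) (2 * b) : Set (Site 2)))
      ((· + ![(a : ℤ), -(b : ℤ)]) '' (topSide (b - a) (2 * b) : Set (Site 2)))) :
    ∃ (u : Site 2) (C : (zdGraph 2).Walk u u), (∀ z ∈ C.support, z ∈ sqAnnulus a b) ∧
      (∀ e ∈ C.edges, e ∈ ω) ∧ walkWinding C 0 ≠ 0 := by
  have hk : ((b - a : ℕ) : ℤ) = b - a := by omega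
  have h2 : ((2 * b : ℕ) : ℤ) = 2 * b := by push_cast; ring
  -- the four open walks
  obtain ⟨aT, bT, T, haT, hbT, hTs, hTe⟩ := exists_walk_of_mem_lrCrossingAt hω hT
  obtain ⟨aB, bB, B, haB, hbB, hBs, hBe⟩ := exists_walk_of_mem_lrCrossingAt hω hB
  obtain ⟨cL, dL, Lf, hcL, hdL, hLs, hLe⟩ := exists_walk_of_mem_tbCrossingAt hω hL
  obtain ⟨cR, dR, Rt, hcR, hdR, hRs, hRe⟩ := exists_walk_of_mem_tbCrossingAt hω hR
  simp only [Matrix.cons_val_zero, Matrix.cons_val_one] at haT hbT hTs haB hbB hBs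
  simp only [Matrix.cons_val_zero, Matrix.cons_val_one] at hcL hdL hLs hcR hdR hRs
  rw [hk] at hTs hBs hLs hRs
  rw [h2] at hbT hTs hbB hBs hdL hLs hdR hRs
  -- coordinates of the four boxes
  have hTs' : ∀ z ∈ T.support, -(b : ℤ) ≤ z 0 ∧ z 0 ≤ b ∧ (a : ℤ) ≤ z 1 ∧ z 1 ≤ b :=
    fun z hz => by have := hTs z hz; omega
  have hBs' : ∀ z ∈ B.support, -(b : ℤ) ≤ z 0 ∧ z 0 ≤ b ∧ -(b : ℤ) ≤ z 1 ∧ z 1 ≤ -a :=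
    fun z hz => by have := hBs z hz; omega
  have hLs' : ∀ z ∈ Lf.support, -(b : ℤ) ≤ z 0 ∧ z 0 ≤ -a ∧ -(b : ℤ) ≤ z 1 ∧ z 1 ≤ b :=
    fun z hz => by have := hLs z hz; omega
  have hRs' : ∀ z ∈ Rt.support, (a : ℤ) ≤ z 0 ∧ z 0 ≤ b ∧ -(b : ℤ) ≤ z 1 ∧ z 1 ≤ b :=
    fun z hz => by have := hRs z hz; omega
  -- all four lie in the big square `[-b, b]²`
  have ha0 : (0 : ℤ) ≤ a := by positivity
  have sqT : ∀ z ∈ T.support, -(b : ℤ) ≤ z 0 ∧ z 0 ≤ b ∧ -(b : ℤ) ≤ z 1 ∧ z 1 ≤ b :=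
    fun z hz => by have := hTs' z hz; omega
  have sqB : ∀ z ∈ B.support, -(b : ℤ) ≤ z 0 ∧ z 0 ≤ b ∧ -(b : ℤ) ≤ z 1 ∧ z 1 ≤ b :=
    fun z hz => by have := hBs' z hz; omega
  have sqL : ∀ z ∈ Lf.support, -(b : ℤ) ≤ z 0 ∧ z 0 ≤ b ∧ -(b : ℤ) ≤ z 1 ∧ z 1 ≤ b :=
    fun z hz => by have := hLs' z hz; omega
  have sqR : ∀ z ∈ Rt.support, -(b : ℤ) ≤ z 0 ∧ z 0 ≤ b ∧ -(b : ℤ) ≤ z 1 ∧ z 1 ≤ b :=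
    fun z hz => by have := hRs' z hz; omega
  have hbT' : bT 0 = b := by omega
  have hbB' : bB 0 = b := by omega
  have hdL' : dL 1 = b := by omega
  have hdR' : dR 1 = b := by omega
  -- the four meeting vertices
  obtain ⟨zTL, hzTL_T, hzTL_L⟩ := exists_mem_support_of_crossing T Lf sqT sqL haT hbT' hcL hdL'
  obtain ⟨zTR, hzTR_T, hzTR_R⟩ := exists_mem_support_of_crossing T Rt sqT sqR haT hbT' hcR hdR'
  obtain ⟨zBL, hzBL_B, hzBL_L⟩ := exists_mem_support_of_crossing B Lf sqB sqL haB hbB' hcL hdL'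
  obtain ⟨zBR, hzBR_B, hzBR_R⟩ := exists_mem_support_of_crossing B Rt sqB sqR haB hbB' hcR hdR'
  -- the four pieces and the closed walk
  classical
  obtain ⟨qT, hqTe, hqTs⟩ := exists_subwalk T hzTL_T hzTR_T
  obtain ⟨qR, hqRe, hqRs⟩ := exists_subwalk Rt hzTR_R hzBR_R
  obtain ⟨qB, hqBe, hqBs⟩ := exists_subwalk B hzBR_B hzBL_B
  obtain ⟨qL, hqLe, hqLs⟩ := exists_subwalk Lf hzBL_L hzTL_L
  set C : (zdGraph 2).Walk zTL zTL := qT.append (qR.append (qB.append qL)) with hC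
  -- winding number `-1` at the face `[0, 1]²`
  have hWT : walkWinding qT 0 = 0 :=
    walkWinding_eq_zero_of_ge (L := (a : ℤ)) (fun z hz => (hTs' z (hqTs z hz)).2.2.1)
      (by simp; omega)
  have hWB : walkWinding qB 0 = 0 :=
    walkWinding_eq_zero_of_le (N := -(a : ℤ)) (fun z hz => (hBs' z (hqBs z hz)).2.2.2)
      (by simp)
  have hWL : walkWinding qL 0 = 0 :=
    walkWinding_eq_zero_of_right (M := -(a : ℤ)) (fun z hz => (hLs' z (hqLs z hz)).2.1)
      (by simp)
  have hWR : walkWinding qR 0 = -1 := by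
    rw [walkWinding_eq_of_forall_right qR (fun z hz => by
      have := (hRs' z (hqRs z hz)).1; simp; omega)]
    have h1' : (a : ℤ) ≤ zTR 1 := (hTs' zTR hzTR_T).2.2.1
    have h2' : zBR 1 ≤ -a := (hBs' zBR hzBR_B).2.2.2
    simp only [Pi.zero_apply, zero_add]
    rw [if_neg (by omega), if_pos (by omega)]
    ring
  have hWC : walkWinding C 0 = -1 := by
    rw [hC, walkWinding_append, walkWinding_append, walkWinding_append, hWT, hWR, hWB, hWL]
    ring
  -- vertices of `C` are in the annulus, edges of `C` are open
  have hmem : ∀ z : Site 2, -(b : ℤ) ≤ z 0 → z 0 ≤ b → -(b : ℤ) ≤ z 1 → z 1 ≤ b →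
      ((a : ℤ) ≤ z 0 ∨ z 0 ≤ -a ∨ (a : ℤ) ≤ z 1 ∨ z 1 ≤ -a) → z ∈ sqAnnulus a b := by
    intro z h0 h0' h1 h1' hor
    rw [mem_sqAnnulus_iff ha]
    refine ⟨fun i => ?_, ?_⟩
    · fin_cases i
      · exact ⟨h0, h0'⟩
      · exact ⟨h1, h1'⟩
    · rcases hor with h | h | h | h
      · exact ⟨0, Or.inl h⟩
      · exact ⟨0, Or.inr h⟩
      · exact ⟨1, Or.inl h⟩
      · exact ⟨1, Or.inr h⟩
  have hCsupp : ∀ z ∈ C.support, z ∈ sqAnnulus a b := by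
    intro z hz
    rw [hC, Walk.mem_support_append_iff, Walk.mem_support_append_iff,
      Walk.mem_support_append_iff] at hz
    rcases hz with hz | hz | hz | hz
    · have := hTs' z (hqTs z hz)
      exact hmem z this.1 this.2.1 (by omega) this.2.2.2 (Or.inr (Or.inr (Or.inl this.2.2.1)))
    · have := hRs' z (hqRs z hz)
      exact hmem z (by omega) this.2.1 this.2.2.1 this.2.2.2 (Or.inl this.1)
    · have := hBs' z (hqBs z hz)
      exact hmem z this.1 this.2.1 this.2.2.1 (by omega) (Or.inr (Or.inr (Or.inr this.2.2.2)))
    · have := hLs' z (hqLs z hz)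
      exact hmem z this.1 (by omega) this.2.2.1 this.2.2.2 (Or.inr (Or.inl this.2.1))
  have hCedges : ∀ e ∈ C.edges, e ∈ ω := by
    intro e he
    rw [hC, Walk.edges_append, Walk.edges_append, Walk.edges_append, List.mem_append,
      List.mem_append, List.mem_append] at he
    rcases he with he | he | he | he
    · exact hTe e (hqTe e he)
    · exact hRe e (hqRe e he)
    · exact hBe e (hqBe e he)
    · exact hLe e (hqLe e he)
  exact ⟨zTL, C, hCsupp, hCedges, by rw [hWC]; norm_num⟩

-- adapted from Literature/Probability/Percolation/ThinAnnulusCircuits.lean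
-- (`exists_pos_le_real_openCircuitInAnnulus`)
/-- **Open winding circuits in square annuli of bounded aspect ratio** (Grimmett 1999, §11.7,
proof of (11.72) via (11.78)): for every `k ≥ 1` there is `ρ > 0` such that the `P_{1/2}`
-probability of an open closed walk of `A_{a,b}` with non-zero winding about `[0,1]²` is `≥ ρ`
for all `1 ≤ a < b` with `2b ≤ k (b - a)` (RSW at aspect ratio `k` for the four boxes of
`sixArmOfFiveArm_exists_windingCircuit_of_crossings`, Harris–FKG for their intersection). -/
theorem sixArmOfFiveArm_exists_pos_le_real_windingCircuit {k : ℕ} (hk : 1 ≤ k) :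
    ∃ ρ : ℝ, 0 < ρ ∧ ∀ a b : ℕ, 1 ≤ a → a < b → 2 * b ≤ k * (b - a) →
      ρ ≤ (bondPercolation (zdGraph 2) half).real {ω | ∃ (u : Site 2) (C : (zdGraph 2).Walk u u),
        (∀ z ∈ C.support, z ∈ sqAnnulus a b) ∧ (∀ e ∈ C.edges, e ∈ ω) ∧ walkWinding C 0 ≠ 0} := by
  obtain ⟨c, hc, hcl⟩ := rsw_half_holds.ratio (k := k) hk
  refine ⟨c ^ 4, by positivity, fun a b ha hab hkab => ?_⟩
  set P := bondPercolation (zdGraph 2) half with hP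
  -- the crossing probability of a `2b × (b - a)` box is at least `c`
  have hbox : c ≤ crossingProb half (2 * b) (b - a) := by
    have h1 : 1 ≤ b - a := by omega
    exact (hcl (b - a) h1).1.trans (crossingProb_anti_left half hkab _)
  -- the four events
  set uT : Site 2 := ![-(b : ℤ), (a : ℤ)] with huT
  set uB : Site 2 := ![-(b : ℤ), -(b : ℤ)] with huB
  set uR : Site 2 := ![(a : ℤ), -(b : ℤ)] with huR
  set ET : Set (BondConfig (Site 2)) := lrCrossingAt uT (2 * b) (b - a) with hET
  set EB : Set (BondConfig (Site 2)) := lrCrossingAt uB (2 * b) (b - a) with hEB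
  set EL : Set (BondConfig (Site 2)) :=
    openCrossing ((· + uB) '' (rectangle (b - a) (2 * b) : Set (Site 2)))
      ((· + uB) '' (bottomSide (b - a) (2 * b) : Set (Site 2)))
      ((· + uB) '' (topSide (b - a) (2 * b) : Set (Site 2))) with hEL
  set ER : Set (BondConfig (Site 2)) :=
    openCrossing ((· + uR) '' (rectangle (b - a) (2 * b) : Set (Site 2)))
      ((· + uR) '' (bottomSide (b - a) (2 * b) : Set (Site 2)))
      ((· + uR) '' (topSide (b - a) (2 * b) : Set (Site 2))) with hER
  set A : Fin 4 → Set (BondConfig (Site 2)) := ![ET, EB, EL, ER] with hA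
  have hAup : ∀ i ∈ (Finset.univ : Finset (Fin 4)), IsUpperSet (A i) := by
    intro i _
    fin_cases i
    · exact isUpperSet_lrCrossingAt _ _ _
    · exact isUpperSet_lrCrossingAt _ _ _
    · exact isUpperSet_openCrossing _ _ _
    · exact isUpperSet_openCrossing _ _ _
  have hAm : ∀ i ∈ (Finset.univ : Finset (Fin 4)), MeasurableSet (A i) := by
    intro i _
    fin_cases i
    · exact measurableSet_lrCrossingAt _ _ _
    · exact measurableSet_lrCrossingAt _ _ _
    · exact measurableSet_tbCrossingAt _ _ _
    · exact measurableSet_tbCrossingAt _ _ _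
  have hAc : ∀ i ∈ (Finset.univ : Finset (Fin 4)), c ≤ P.real (A i) := by
    intro i _
    fin_cases i
    · show c ≤ P.real ET; rw [hET, hP, bondPercolation_real_lrCrossingAt]; exact hbox
    · show c ≤ P.real EB; rw [hEB, hP, bondPercolation_real_lrCrossingAt]; exact hbox
    · show c ≤ P.real EL; rw [hEL, hP, bondPercolation_real_tbCrossingAt]; exact hbox
    · show c ≤ P.real ER; rw [hER, hP, bondPercolation_real_tbCrossingAt]; exact hbox
  have hFKG : c ^ 4 ≤ P.real (⋂ i ∈ (Finset.univ : Finset (Fin 4)), A i) := by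
    have := pow_card_le_real_biInter (zdGraph 2) half Finset.univ A hAup hAm hc.le hAc
    simpa using this
  -- on the intersection (and a lattice configuration) the circuit event occurs
  have hae : (⋂ i ∈ (Finset.univ : Finset (Fin 4)), A i) ≤ᵐ[P]
      {ω | ∃ (u : Site 2) (C : (zdGraph 2).Walk u u),
        (∀ z ∈ C.support, z ∈ sqAnnulus a b) ∧ (∀ e ∈ C.edges, e ∈ ω) ∧ walkWinding C 0 ≠ 0} :=
    (ae_subset_edgeSet (zdGraph 2) half).mono fun ω hω h =>
      have h' : ∀ i, ω ∈ A i := fun i => Set.mem_iInter₂.1 h i (Finset.mem_univ i)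
      sixArmOfFiveArm_exists_windingCircuit_of_crossings ha hab hω (h' 0) (h' 1) (h' 2) (h' 3)
  exact hFKG.trans (ENNReal.toReal_mono (measure_ne_top _ _) (measure_mono_ae hae))

/-- **The winding-circuit event of `A_{a,b}` depends only on the pairs of annulus sites**: the
closed walk lies in the annulus, so its edges are pairs of annulus sites. -/
theorem sixArmOfFiveArm_determinedBy_windingCircuit (a b : ℕ) :
    DeterminedBy {ω : BondConfig (Site 2) | ∃ (u : Site 2) (C : (zdGraph 2).Walk u u),
        (∀ z ∈ C.support, z ∈ sqAnnulus a b) ∧ (∀ e ∈ C.edges, e ∈ ω) ∧ walkWinding C 0 ≠ 0}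
      ↑((annulus 2 (a - 1) b).sym2) := by
  classical
  -- an edge of a walk inside the annulus is a pair of annulus sites, hence has the same state
  have hag : ∀ (ω ω' : BondConfig (Site 2)),
      ω ∩ ↑((annulus 2 (a - 1) b).sym2) = ω' ∩ ↑((annulus 2 (a - 1) b).sym2) →
      ∀ {u v : Site 2} (W : (zdGraph 2).Walk u v), (∀ z ∈ W.support, z ∈ sqAnnulus a b) →
      ∀ e ∈ W.edges, e ∈ ω → e ∈ ω' := by
    intro ω ω' h u v W hW e he heω
    have heF : e ∈ (↑((annulus 2 (a - 1) b).sym2) : Set (Sym2 (Site 2))) := by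
      rw [Walk.edges, List.mem_map] at he
      obtain ⟨d, hd, rfl⟩ := he
      exact Finset.mem_coe.2 (Finset.mk_mem_sym2_iff.2
        ⟨Finset.mem_coe.1 (hW _ (W.dart_fst_mem_support_of_mem_darts hd)),
          Finset.mem_coe.1 (hW _ (W.dart_snd_mem_support_of_mem_darts hd))⟩)
    exact ((Set.ext_iff.1 h e).1 ⟨heω, heF⟩).1
  suffices key : ∀ ω ω' : BondConfig (Site 2),
      ω ∩ ↑((annulus 2 (a - 1) b).sym2) = ω' ∩ ↑((annulus 2 (a - 1) b).sym2) →
        ω ∈ {ω : BondConfig (Site 2) | ∃ (u : Site 2) (C : (zdGraph 2).Walk u u),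
          (∀ z ∈ C.support, z ∈ sqAnnulus a b) ∧ (∀ e ∈ C.edges, e ∈ ω) ∧ walkWinding C 0 ≠ 0} →
        ω' ∈ {ω : BondConfig (Site 2) | ∃ (u : Site 2) (C : (zdGraph 2).Walk u u),
          (∀ z ∈ C.support, z ∈ sqAnnulus a b) ∧ (∀ e ∈ C.edges, e ∈ ω) ∧
            walkWinding C 0 ≠ 0} by
    rw [determinedBy_iff]
    exact fun ω ω' h => ⟨key ω ω' h, key ω' ω h.symm⟩
  rintro ω ω' h ⟨u, C, hCs, hCe, hCW⟩
  exact ⟨u, C, hCs, fun e he => hag ω ω' h C hCs e he (hCe e he), hCW⟩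

/-- **Geometric annuli: no winding circuit in `J` of them costs `q^J`.**  If every thin annulus
`A_{a,b}` with `a₀ ≤ a < b`, `2b ≤ 4(b - a)` carries an open winding circuit with
`P_{1/2}`-probability `≥ 1 - q`, then for `m ≥ max(a₀, 1)` the event "no open winding circuit in
any of the annuli `A_{4ⁱm, 2·4ⁱm}`, `i < J`" has probability at most `q ^ J` (the annuli have
pairwise disjoint vertex sets, so the events are independent under the product measure,
`bondPercolation_real_biInter_eq_prod`). -/
theorem sixArmOfFiveArm_real_noWindingCircuits_le_pow {q : ℝ} {a₀ : ℕ}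
    (hcirc : ∀ a b : ℕ, a₀ ≤ a → a < b → 2 * b ≤ 4 * (b - a) →
      1 - q ≤ (bondPercolation (zdGraph 2) half).real {ω | ∃ (u : Site 2)
        (C : (zdGraph 2).Walk u u), (∀ z ∈ C.support, z ∈ sqAnnulus a b) ∧
          (∀ e ∈ C.edges, e ∈ ω) ∧ walkWinding C 0 ≠ 0})
    {m : ℕ} (hm0 : a₀ ≤ m) (hm1 : 1 ≤ m) (J : ℕ) :
    (bondPercolation (zdGraph 2) half).real (⋂ i ∈ Finset.range J,
        {ω : BondConfig (Site 2) | ∃ (u : Site 2) (C : (zdGraph 2).Walk u u),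
          (∀ z ∈ C.support, z ∈ sqAnnulus (4 ^ i * m) (2 * (4 ^ i * m))) ∧
            (∀ e ∈ C.edges, e ∈ ω) ∧ walkWinding C 0 ≠ 0}ᶜ) ≤ q ^ J := by
  classical
  set P := bondPercolation (zdGraph 2) half with hP
  set D : ℕ → Set (BondConfig (Site 2)) := fun i =>
    {ω : BondConfig (Site 2) | ∃ (u : Site 2) (C : (zdGraph 2).Walk u u),
      (∀ z ∈ C.support, z ∈ sqAnnulus (4 ^ i * m) (2 * (4 ^ i * m))) ∧
        (∀ e ∈ C.edges, e ∈ ω) ∧ walkWinding C 0 ≠ 0} with hD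
  set T : ℕ → Set (Sym2 (Site 2)) := fun i =>
    (↑((annulus 2 (4 ^ i * m - 1) (2 * (4 ^ i * m))).sym2) : Set (Sym2 (Site 2))) with hT
  have hpow : ∀ i : ℕ, m ≤ 4 ^ i * m := fun i =>
    Nat.le_mul_of_pos_left m (Nat.one_le_pow _ _ (by norm_num))
  have hdet : ∀ i ∈ Finset.range J, DeterminedBy (D i)ᶜ (T i) := fun i _ => by
    rw [determinedBy_iff]
    intro ω ω' h
    rw [Set.mem_compl_iff, Set.mem_compl_iff,
      (determinedBy_iff _ _).1 (sixArmOfFiveArm_determinedBy_windingCircuit _ _) ω ω' h]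
  have hmeas : ∀ i ∈ Finset.range J, MeasurableSet (D i)ᶜ := fun i _ =>
    (sixArmOfFiveArm_determinedBy_windingCircuit (4 ^ i * m) (2 * (4 ^ i * m))).measurableSet_of_finset.compl
  -- the supports are pairwise disjoint
  have hdisj : (↑(Finset.range J) : Set ℕ).PairwiseDisjoint T := by
    intro i _ j _ hij
    -- the vertex sets of the annuli are disjoint
    have key : ∀ i j : ℕ, i < j → ∀ v : Site 2,
        v ∈ annulus 2 (4 ^ i * m - 1) (2 * (4 ^ i * m)) →
          v ∉ annulus 2 (4 ^ j * m - 1) (2 * (4 ^ j * m)) := by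
      intro i j hij v hv hv'
      rw [mem_annulus] at hv hv'
      have h1 : 4 ^ (i + 1) ≤ 4 ^ j := Nat.pow_le_pow_right (by norm_num) hij
      have h2 : 4 ^ (i + 1) * m ≤ 4 ^ j * m := Nat.mul_le_mul_right m h1
      have h3 : 4 ^ (i + 1) * m = 4 * (4 ^ i * m) := by ring
      have h4 := hpow i
      apply hv'.2
      refine box_mono 2 ?_ hv.1
      omega
    show Disjoint (T i) (T j)
    rw [Set.disjoint_left]
    intro e he he'
    induction e using Sym2.ind with
    | h x y =>
      have hx : x ∈ annulus 2 (4 ^ i * m - 1) (2 * (4 ^ i * m)) :=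
        (Finset.mk_mem_sym2_iff.1 (Finset.mem_coe.1 he)).1
      have hx' : x ∈ annulus 2 (4 ^ j * m - 1) (2 * (4 ^ j * m)) :=
        (Finset.mk_mem_sym2_iff.1 (Finset.mem_coe.1 he')).1
      rcases lt_or_gt_of_ne hij with hlt | hlt
      · exact key i j hlt x hx hx'
      · exact key j i hlt x hx' hx
  rw [bondPercolation_real_biInter_eq_prod (zdGraph 2) half (Finset.range J) (fun i => (D i)ᶜ) T
    hdet hmeas hdisj]
  have hq : ∀ i ∈ Finset.range J, P.real (D i)ᶜ ≤ q := by
    intro i _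
    have h4 := hpow i
    have hmeasD : MeasurableSet (D i) :=
      (sixArmOfFiveArm_determinedBy_windingCircuit (4 ^ i * m) (2 * (4 ^ i * m))).measurableSet_of_finset
    rw [probReal_compl_eq_one_sub hmeasD]
    have := hcirc (4 ^ i * m) (2 * (4 ^ i * m)) (by omega) (by omega) (by omega)
    linarith
  calc ∏ i ∈ Finset.range J, P.real (D i)ᶜ ≤ ∏ _i ∈ Finset.range J, q :=
        Finset.prod_le_prod (fun i _ => measureReal_nonneg) hq
    _ = q ^ J := by rw [Finset.prod_const, Finset.card_range]

/-- **Polynomial decay of "no open winding circuit in the geometric sub-annuli of `A_{m,n}`"**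
(critical bond percolation on `ℤ²`): there are `c, a > 0` and, for all `2 ≤ m ≤ n`, a number
`J = J(m,n)` of geometric annuli `A_{4ⁱm, 2·4ⁱm} ⊆ A_{m,n}` (`i < J`) such that the probability that
none of them carries an open closed walk of non-zero winding about `[0,1]²` is at most `c (m/n)^a`
(`J ≍ log₄ (n/m)` annuli, each blocked independently with probability `≤ q = max(1 - ρ₄, 1/4) < 1`
by RSW; `a = log_{1/4} q`, `c = 2^a`; Grimmett 1999 §11.7, Kesten 1982 §2). -/
theorem sixArmOfFiveArm_real_noWindingCircuits_le_rpow :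
    ∃ c a : ℝ, 0 < c ∧ 0 < a ∧ ∀ m n : ℕ, 2 ≤ m → m ≤ n → ∃ J : ℕ,
      (∀ i < J, 2 * (4 ^ i * m) ≤ n) ∧
      (bondPercolation (zdGraph 2) half).real (⋂ i ∈ Finset.range J,
        {ω : BondConfig (Site 2) | ∃ (u : Site 2) (C : (zdGraph 2).Walk u u),
          (∀ z ∈ C.support, z ∈ sqAnnulus (4 ^ i * m) (2 * (4 ^ i * m))) ∧
            (∀ e ∈ C.edges, e ∈ ω) ∧ walkWinding C 0 ≠ 0}ᶜ) ≤ c * ((m : ℝ) / n) ^ a := by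
  obtain ⟨ρs, hρs, hcirc⟩ := sixArmOfFiveArm_exists_pos_le_real_windingCircuit (k := 4) (by norm_num)
  -- the decay rate
  set q : ℝ := max (1 - ρs) (1 / 4) with hq
  have hq0 : 0 < q := lt_of_lt_of_le (by norm_num) (le_max_right _ _)
  have hq1 : q < 1 := max_lt (by linarith) (by norm_num)
  have h14 : (0 : ℝ) ≤ 1 / 4 := by norm_num
  set α : ℝ := Real.logb (1 / 4) q with hα
  have hα0 : 0 < α := Real.logb_pos_of_base_lt_one (by norm_num) (by norm_num) hq0 hq1
  have hqα : (1 / 4 : ℝ) ^ α = q := Real.rpow_logb (by norm_num) (by norm_num) hq0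
  refine ⟨(2 : ℝ) ^ α, α, by positivity, hα0, fun m n hm hmn => ?_⟩
  -- the number `J` of geometric annuli between `m` and `n`
  obtain ⟨J, hJ1, hJ2⟩ : ∃ J : ℕ, (∀ i < J, 2 * (4 ^ i * m) ≤ n) ∧ n < 2 * (4 ^ J * m) := by
    refine ⟨Nat.clog 4 (n / (2 * m) + 1), fun i hi => ?_, ?_⟩
    · have h4 : 4 ^ i < n / (2 * m) + 1 := (Nat.lt_clog_iff_pow_lt (by norm_num)).1 hi
      have h5 : 4 ^ i * (2 * m) ≤ n / (2 * m) * (2 * m) :=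
        Nat.mul_le_mul_right (2 * m) (Nat.lt_succ_iff.1 h4)
      have h6 : n / (2 * m) * (2 * m) ≤ n := Nat.div_mul_le_self _ _
      have e1 : 4 ^ i * (2 * m) = 2 * (4 ^ i * m) := by ring
      omega
    · have h4 : n / (2 * m) + 1 ≤ 4 ^ Nat.clog 4 (n / (2 * m) + 1) :=
        Nat.le_pow_clog (by norm_num) _
      have h5 : n < n / (2 * m) * (2 * m) + 2 * m := Nat.lt_div_mul_add (by omega)
      have h6 : (n / (2 * m) + 1) * (2 * m) ≤
          4 ^ Nat.clog 4 (n / (2 * m) + 1) * (2 * m) := Nat.mul_le_mul_right (2 * m) h4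
      have e2 : (n / (2 * m) + 1) * (2 * m) = n / (2 * m) * (2 * m) + 2 * m := by
        ring
      have e3 : 4 ^ Nat.clog 4 (n / (2 * m) + 1) * (2 * m) =
          2 * (4 ^ Nat.clog 4 (n / (2 * m) + 1) * m) := by ring
      omega
  refine ⟨J, hJ1, ?_⟩
  -- the probability bound `q ^ J`
  have hP := sixArmOfFiveArm_real_noWindingCircuits_le_pow (q := q) (a₀ := 1)
    (fun a b h1 h2 h3 => by
      have := hcirc a b h1 h2 h3
      linarith [le_max_left (1 - ρs) (1 / 4 : ℝ)]) (m := m) (by omega) (by omega) J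
  -- arithmetic: `q ^ J = ((1/4)^J)^α ≤ (2 m / n)^α`
  have hn0 : (0 : ℝ) < n := by exact_mod_cast (show 0 < n by omega)
  have h4J : (0 : ℝ) < (4 : ℝ) ^ J := by positivity
  have hratio : ((1 : ℝ) / 4) ^ J ≤ 2 * ((m : ℝ) / n) := by
    rw [one_div_pow, div_le_iff₀ h4J,
      show 2 * ((m : ℝ) / n) * 4 ^ J = 2 * (4 ^ J * m) / n by ring, le_div_iff₀ hn0, one_mul]
    exact_mod_cast hJ2.le
  calc (bondPercolation (zdGraph 2) half).real (⋂ i ∈ Finset.range J,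
        {ω : BondConfig (Site 2) | ∃ (u : Site 2) (C : (zdGraph 2).Walk u u),
          (∀ z ∈ C.support, z ∈ sqAnnulus (4 ^ i * m) (2 * (4 ^ i * m))) ∧
            (∀ e ∈ C.edges, e ∈ ω) ∧ walkWinding C 0 ≠ 0}ᶜ)
        ≤ q ^ J := hP
    _ = (((1 : ℝ) / 4) ^ J) ^ α := by rw [← hqα, Real.rpow_pow_comm h14]
    _ ≤ (2 * ((m : ℝ) / n)) ^ α := Real.rpow_le_rpow (by positivity) hratio hα0.le
    _ = (2 : ℝ) ^ α * ((m : ℝ) / n) ^ α := Real.mul_rpow (by norm_num) (by positivity)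

end Summit.CriticalPhenomena.CardyFormulaZ2.Cruxes.LagHandOff.HittingTournament

end
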